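import Summits.ABC.IUTFork.Conditional.AbcOfSGenuine
import Summits.ABC.IUTFork.Cor312ProvenanceDHWitness
import Summits.ABC.ABC.Theorems.IUTThetaPilotThetaPartIIULineCapstone
import HarnessLib

/-!
# Branch C certificate AT THE GENUINE SETTING with the Dupuy–Hilado pilot datum FIXED to the datum's own — apex form `abc_of_S_v4X`

PROOF-ONLY sibling (0 definitions, 0 `Prop` facts, nothing restated; ONE theorem) of `Conditional/AbcOfSGenuine.lean` (abc-iut-C-cert-2,
p430884: `cor312Of_of_SH_genuine`, per datum S_H 1 · PIN 1 (+ idele side 5) · FACT 0 · CONE 0 · READ 4 = 11 named), of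
`Conditional/AbcOfSGenuineRegime.lean` (abc-iut-C-cert-1, p431657: `abc_of_S_v4`) and of `Conditional/AbcOfSGenuineOwn.lean` (abc-iut-C-cert-1,
p432254: the PER-DATUM form `cor312Of_of_SH_genuine_own` at `X := Cor312Prov.pilotDataOfF D`, 11 → 10 named). Row «hX-DISCHARGE» (HOME/STATUS
2026-08-26T08:13:34Z offer / 08:15:07Z take), apex half, written by abc-iut-w5-d113 (gen 6). TAKES NO SIDE on [IUTchIII] Cor. 3.12.

WHAT CHANGES. In `abc_of_S_v4` the S_H-bundle `H` asks, per admissible `(λ, l)` and genuine Θ-volume datum `T`, for `∃ X : PilotData T.F` with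
the [READ] conjunct `Cor312Prov.IsPilotDataOf T.D X` among ≈ 45 existential components. abc-iut-w5-d231's `Cor312ProvenanceDHWitness.lean`
CONSTRUCTS that datum from `T.D` itself — `Cor312Prov.pilotDataOfF T.D = (j(E_F), S := 𝕍(F)^bad, l)` ([cite: DupuyHilado2025, §3.3]
«`(F, j_E, S, l)`»; [IUTchI] Def. 3.1 (b), (c)) — and PROVES `Cor312Prov.isPilotDataOf_pilotDataOfF`. Here:

* `abc_of_S_v4X` — the X-explicit form of `abc_of_S_v4`: the bundle `HX` no longer quantifies `∃ X : PilotData T.F` and no longer carries the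
  conjunct `IsPilotDataOf T.D X` — the setting data are asked for AT `X := pilotDataOfF T.D`; the S-layer binder `hreg` is `abc_of_S_v4`'s
  verbatim (c312-8 `stub_hullRegime` body). Per datum the proof is C-cert-2's `cor312Of_of_SH_genuine` BY NAME with `hX :=
  isPilotDataOf_pilotDataOfF T.D` (i.e. C-cert-1's `cor312Of_of_SH_genuine_own` unfolded one step — that module was not yet built when this
  file was checked, hence the parent is called directly); downstream BY NAME and unchanged: c312-8's (U)-line capstone
  `Summit.ABC.ABC.Theorems.ThetaPartII.ABC_of_cor312_of_hullRegime` (p428563; `genEllTwo_holds`, `JInvWlog_proof` inside).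
  RELATION TO v4 (honest): `HX → H` (instantiate v4's `∃ X` at `pilotDataOfF T.D` with `isPilotDataOf_pilotDataOfF`), so `abc_of_S_v4X` is the
  COROLLARY of `abc_of_S_v4` at the canonical pilot datum — an explicitation (one existential and one [READ] conjunct fewer in the bundle),
  NOT a strengthening and NOT a new scoreboard revision (the `abc_of_S_vN` series stays abc-iut-C-cert's; apex explicit count unchanged: 2).

What is NOT discharged here and why (unchanged from the parents' docstrings): [READ] `hplaces` — the index bijection
`(thetaIndex X).V ≃ D.V` compatible with `𝕍^bad` is closable only under abc-iut-c312-7's genuine restriction «no bad place of `F_mod` with two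
places of `F` above it» (c312-7/c312-8 lane); [PIN-side] `htq0/htq1/htq/ht0/ht1` — inhabited only by REALISING ideles in the completions
`F_v` (M-level, `exists_ideles_settingPrVolSharp` needs `2l ∣ ord_v(q_v)` along `𝕍̲`); [READ] `hΘ` — the one-sided Θ-identification
(C312-RESIDUALS §1a′, M-level); [S_H] `hSH` + [PIN] `hQPin` — at the genuine setting this group IS the adjudication inequality
(`Conditional/AbcOfSGenuineAntecedent.lean` p431727, `thetaSide_of_exists_qPinned_and_hull_settingPrVolSharp`): open either way in the kernel.

HONEST FRAMING: this campaign LOCATES / CONDITIONALLY VERIFIES. Nothing here asserts that abc is proved or refuted, or that [IUTchIII]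
Cor. 3.12 holds or fails at any datum, or takes a side on any author (Mochizuki / Scholze–Stix / Joshi / Dupuy–Hilado); statements about OUR
typed objects; «`ABC` follows from S_H + the listed hypotheses AS TYPED», nothing more; typed ≠ proved; instantiated ≠ endorsed.
[claim: Mochizuki2012, status: disputed] [cite: DupuyHilado2025, §3.3]
-/
noncomputable section

namespace Summit.ABC.IUTFork.Conditional

open Thm311 Thm311.Real Cor312 Cor312Vol Cor312Prov
open Literature.IUT.LogThetaLattice Literature.IUT.LogVolume Literature.IUT.HodgeTheaters
open Literature.NumberTheory.DiophantineGeometry.GenEll NumberField IsDedekindDomain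

/-- **`abc_of_S_v4X` — the X-explicit form of abc-iut-C-cert-1's `abc_of_S_v4`**: the branch-C certificate at the genuine
print-normalised assembled real setting (hull-level line S_H) in which, for every admissible `(λ, l)` and every genuine Θ-volume datum
`T`, the setting data are asked for AT THE DATUM'S OWN Dupuy–Hilado pilot datum `Cor312Prov.pilotDataOfF T.D` — so the bundle `HX` has no
`∃ X : PilotData T.F` and no `IsPilotDataOf T.D X` conjunct (abc-iut-w5-d231's `isPilotDataOf_pilotDataOfF`, PROVED; per-datum form of record: abc-iut-C-cert-1's
`cor312Of_of_SH_genuine_own`, p432254). [S_H-bundle] `HX`: at `X := pilotDataOfF T.D` there EXIST the auxiliary field `M`, archimedean/(b)(c) data,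
column binders, lattice/Frobenioid/pilot context, ideles `t`, `tq`, PR-1's `ρ`, `qK` with the idele side conditions, the index bijection,
`PilotKummerCompatHull`, the q-pin and the one-sided Θ-identification; [CONE, layer S] `hreg`: `abc_of_S_v4`'s verbatim (c312-8
`stub_hullRegime` body — the hull estimate with print's `B_III(λ,l)` at NON-slot-constant genuine data only). Downstream BY NAME:
`Summit.ABC.ABC.Theorems.ThetaPartII.ABC_of_cor312_of_hullRegime` (p428563). HONEST RELATION: `HX → H` of `abc_of_S_v4`, so this is the
COROLLARY of `abc_of_S_v4` at the canonical pilot datum (an explicitation), not a strengthening and not a scoreboard revision.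
«`ABC` follows from S_H + these hypotheses as typed», nothing more; no side taken on [IUTchIII] Cor. 3.12 or on any author;
typed ≠ proved. [claim: Mochizuki2012, status: disputed] [cite: DupuyHilado2025, §3.3] -/
theorem abc_of_S_v4X
    (HX : ∀ P₀ : NFPoint, P₀ ∈ UP → ∀ l : ℕ, l.Prime → 5 ≤ l →
      Cor22.AdmitsCore P₀ → Cor22.CondP2 P₀ l → Cor22.CondP5 P₀ l → Cor22.CondP6 P₀ l →
      ∀ T : Cor22.ThetaVolumeDatumAt P₀ l,
        letI := T.instFieldF; letI := T.instNumberFieldF; letI := T.instFieldK; letI := T.instNumberFieldK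
        letI := T.instAlgebraK; letI := T.instFieldFbar; letI := T.instAlgebraFbar; letI := T.instAlgebraKFbar
        letI := T.instIsElliptic
        ∃ (M : Type) (_ : Field M) (_ : NumberField M)
          (archPk : ∀ (j : (thetaIndex (pilotDataOfF T.D)).Label) (vQ : (thetaIndex (pilotDataOfF T.D)).VQ),
            Set ((logShellsDH (pilotDataOfF T.D) (analyticLogv T.F)).Packet j vQ))
          (archSub : ∀ (j : (thetaIndex (pilotDataOfF T.D)).Label) (v : (thetaIndex (pilotDataOfF T.D)).V),
            Set ((logShellsDH (pilotDataOfF T.D) (analyticLogv T.F)).Packet j ((thetaIndex (pilotDataOfF T.D)).over v)))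
          (Ψ : ℤ → ∀ v : (thetaIndex (pilotDataOfF T.D)).V, v ∈ (thetaIndex (pilotDataOfF T.D)).Vbad →
            Set ((logShellsDH (pilotDataOfF T.D) (analyticLogv T.F)).StarPacket v))
          (act : ℤ → ∀ v : (thetaIndex (pilotDataOfF T.D)).V, v ∈ (thetaIndex (pilotDataOfF T.D)).Vbad →
            (logShellsDH (pilotDataOfF T.D) (analyticLogv T.F)).StarPacket v →
              Module.End ℚ ((logShellsDH (pilotDataOfF T.D) (analyticLogv T.F)).StarPacket v))
          (Mmod : ℤ → ∀ j : (thetaIndex (pilotDataOfF T.D)).LabelStar,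
            Set ((logShellsDH (pilotDataOfF T.D) (analyticLogv T.F)).GlobalPacket j.1))
          (region : ℤ → ∀ j : (thetaIndex (pilotDataOfF T.D)).LabelStar, FinDivisor M →
            ∀ vQ : (thetaIndex (pilotDataOfF T.D)).VQ, Set ((logShellsDH (pilotDataOfF T.D) (analyticLogv T.F)).Packet j.1 vQ))
          (frobAdm : ℤ → ℤ → ∀ (j : (thetaIndex (pilotDataOfF T.D)).Label) (vQ : (thetaIndex (pilotDataOfF T.D)).VQ),
            Set ((logShellsDH (pilotDataOfF T.D) (analyticLogv T.F)).Packet j vQ) → Prop)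
          (frobLogvol : ℤ → ℤ → ∀ (j : (thetaIndex (pilotDataOfF T.D)).Label) (vQ : (thetaIndex (pilotDataOfF T.D)).VQ),
            Set ((logShellsDH (pilotDataOfF T.D) (analyticLogv T.F)).Packet j vQ) → ℝ)
          (frobΨ : ℤ → ℤ → ∀ v : (thetaIndex (pilotDataOfF T.D)).V, v ∈ (thetaIndex (pilotDataOfF T.D)).Vbad →
            Set ((logShellsDH (pilotDataOfF T.D) (analyticLogv T.F)).StarPacket v))
          (frobMmod : ℤ → ℤ → ∀ j : (thetaIndex (pilotDataOfF T.D)).LabelStar,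
            Set ((logShellsDH (pilotDataOfF T.D) (analyticLogv T.F)).GlobalPacket j.1))
          (unitImage : ℤ → ℤ → ℕ → ∀ (j : (thetaIndex (pilotDataOfF T.D)).Label) (vQ : (thetaIndex (pilotDataOfF T.D)).VQ),
            Set ((logShellsDH (pilotDataOfF T.D) (analyticLogv T.F)).Packet j vQ))
          (ballImage : ℤ → ℤ → ∀ (j : (thetaIndex (pilotDataOfF T.D)).Label) (vQ : (thetaIndex (pilotDataOfF T.D)).VQ),
            Set ((logShellsDH (pilotDataOfF T.D) (analyticLogv T.F)).Packet j vQ))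
          (thetaDiv : ℤ → ℤ → LgpDivisor M (thetaIndex (pilotDataOfF T.D)).lstar)
          (n : ℤ) (HT : Type) (LogLink : HT → HT → Type) (IsFull : ∀ {s t : HT}, LogLink s t → Prop)
          (lat : LGPGaussianLogThetaLattice LogLink IsFull)
          (Frd : Type) (IsoF : Frd → Frd → Type) (Ob : Frd → Type) (realify : Frd → Frd) (Strip : Type)
          (IsoS : Strip → Strip → Type)
          (Mv : ∀ v : (thetaIndex (pilotDataOfF T.D)).V, v ∈ (thetaIndex (pilotDataOfF T.D)).Vbad → Type)
          (_ : ∀ v h, Monoid (Mv v h))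
          (sig : GlobalLGPFrobenioidSignature (thetaIndex (pilotDataOfF T.D)).lstar (thetaIndex (pilotDataOfF T.D)).V
            (· ∈ (thetaIndex (pilotDataOfF T.D)).Vbad) Frd IsoF Ob realify Strip IsoS Mv)
          (split : SplittingMonoids Mv) (ObΔ : Type)
          (N : ∀ v : (thetaIndex (pilotDataOfF T.D)).V, v ∈ (thetaIndex (pilotDataOfF T.D)).Vbad → Type)
          (_ : ∀ v h, Monoid (N v h)) (qData : QPilotData ObΔ N)
          (tq : ∀ (pp : Nat.Primes) (x : (thetaIndex (pilotDataOfF T.D)).Fibre (.inr pp)),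
            haveI : Fact (pp : ℕ).Prime := ⟨pp.2⟩; kOf (pilotDataOfF T.D) pp.1 x)
          (t : ∀ (pp : Nat.Primes) (_ : Fin (pilotDataOfF T.D).lstar) (x : (thetaIndex (pilotDataOfF T.D)).Fibre (.inr pp)),
            haveI : Fact (pp : ℕ).Prime := ⟨pp.2⟩; kOf (pilotDataOfF T.D) pp.1 x)
          (ρ : (∀ v : (thetaIndex (pilotDataOfF T.D)).V, v ∈ (thetaIndex (pilotDataOfF T.D)).Vbad →
              Set ((logShellsDH (pilotDataOfF T.D) (analyticLogv T.F)).StarPacket v)) →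
            ∀ (j : (thetaIndex (pilotDataOfF T.D)).Label) (vQ : (thetaIndex (pilotDataOfF T.D)).VQ),
              Set ((logShellsDH (pilotDataOfF T.D) (analyticLogv T.F)).Packet j vQ))
          (qK : ∀ v : (thetaIndex (pilotDataOfF T.D)).V, v ∈ (thetaIndex (pilotDataOfF T.D)).Vbad →
            Set ((logShellsDH (pilotDataOfF T.D) (analyticLogv T.F)).StarPacket v))
          (htq0 : ∀ pp x, tq pp x ≠ 0)
          (htq1 : ∀ (pp : Nat.Primes) (x : (thetaIndex (pilotDataOfF T.D)).Fibre (.inr pp)),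
            haveI : Fact (pp : ℕ).Prime := ⟨pp.2⟩
            placeOf (pilotDataOfF T.D) pp.1 x ∉ (pilotDataOfF T.D).S → ‖tq pp x‖ = 1)
          (_ : ∀ (pp : Nat.Primes) (x : (thetaIndex (pilotDataOfF T.D)).Fibre (.inr pp)),
            haveI : Fact (pp : ℕ).Prime := ⟨pp.2⟩
            Real.log ‖tq pp x‖ = -((pilotDataOfF T.D).qPilot (placeOf (pilotDataOfF T.D) pp.1 x)) *
              logNorm T.F (placeOf (pilotDataOfF T.D) pp.1 x) / localDegree T.F (placeOf (pilotDataOfF T.D) pp.1 x))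
          (_ : ∀ pp i x, t pp i x ≠ 0)
          (_ : ∀ (pp : Nat.Primes) (i : Fin (pilotDataOfF T.D).lstar) (x : (thetaIndex (pilotDataOfF T.D)).Fibre (.inr pp)),
            haveI : Fact (pp : ℕ).Prime := ⟨pp.2⟩
            placeOf (pilotDataOfF T.D) pp.1 x ∉ (pilotDataOfF T.D).S → ‖t pp i x‖ = 1)
          (_ : ∃ e : (thetaIndex (pilotDataOfF T.D)).V ≃ T.D.V, ∀ v : (thetaIndex (pilotDataOfF T.D)).V,
            v ∈ (thetaIndex (pilotDataOfF T.D)).Vbad ↔ ((e v : T.D.V) : Val T.K) ∈ T.D.Vbad),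
          Cor312Vol.PilotKummerCompatHull
              (LatticeSituation.ofShells (logShellsDH (pilotDataOfF T.D) (analyticLogv T.F)) M archPk archSub
                (summandPiecesPr (pilotDataOfF T.D) (logvAnalytic_analyticLogv (F := T.F))).Adm
                (summandPiecesPr (pilotDataOfF T.D) (logvAnalytic_analyticLogv (F := T.F))).logvol Ψ act Mmod region
                frobAdm frobLogvol frobΨ frobMmod unitImage ballImage thetaDiv)
              (settingPrVolSharp (pilotDataOfF T.D) (logvAnalytic_analyticLogv (F := T.F)) M archPk archSub Ψ act Mmod
                region n lat sig split qData tq t htq0 htq1) ρ qK ∧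
            Cor312Vol.QPinned
              (LatticeSituation.ofShells (logShellsDH (pilotDataOfF T.D) (analyticLogv T.F)) M archPk archSub
                (summandPiecesPr (pilotDataOfF T.D) (logvAnalytic_analyticLogv (F := T.F))).Adm
                (summandPiecesPr (pilotDataOfF T.D) (logvAnalytic_analyticLogv (F := T.F))).logvol Ψ act Mmod region
                frobAdm frobLogvol frobΨ frobMmod unitImage ballImage thetaDiv)
              (settingPrVolSharp (pilotDataOfF T.D) (logvAnalytic_analyticLogv (F := T.F)) M archPk archSub Ψ act Mmod
                region n lat sig split qData tq t htq0 htq1) ρ qK ∧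
            (settingPrVolSharp (pilotDataOfF T.D) (logvAnalytic_analyticLogv (F := T.F)) M archPk archSub Ψ act Mmod
                region n lat sig split qData tq t htq0 htq1).negLogTheta ≤ ((T.negLogTheta : ℝ) : WithTop ℝ))
    -- [CONE, layer S] `abc_of_S_v4`'s verbatim: the route's own open residue `stub_hullRegime` (RISK ¶7)
    (hreg : ∀ P : NFPoint, P ∈ UP → ∀ l : ℕ, l.Prime → 5 ≤ l →
      Cor22.AdmitsCore P → Cor22.CondP2 P l → Cor22.CondP5 P l → Cor22.CondP6 P l →
      ∀ T : Cor22.ThetaVolumeDatumAt P l,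
        (letI := T.instFieldF; letI := T.instNumberFieldF; letI := T.instAlgebraF; letI := T.instFieldK
         letI := T.instNumberFieldK; letI := T.instAlgebraK; letI := T.instFieldFbar; letI := T.instAlgebraFbar
         letI := T.instAlgebraKFbar; letI := T.instIsElliptic
         ¬ (∀ p ∈ T.I.supportPrimes, ∀ v w : placesOver (fieldOfModuli T.E) p,
            (Summit.ABC.IUTFork.DHData.ofInput T.I).logQloc p v = (Summit.ABC.IUTFork.DHData.ofInput T.I).logQloc p w)) →
        T.HullEstimateOf
          (((l : ℝ) + 1) / 4 *
            ((1 + 12 * (Cor22.dmod P : ℝ) / l) * (P.logDiff + Cor22.logCondAvoid P {2, l})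
              + 2 * Real.log l + 52
              + 20 / 3 * Real.log (((2 ^ 12 * 3 ^ 3 * 5 * Cor22.dmod P : ℕ) : ℝ) * (l : ℝ))
                * (Nat.primeCounting (2 ^ 12 * 3 ^ 3 * 5 * Cor22.dmod P * l) : ℝ)))) :
    _root_.ABC := by
  refine Summit.ABC.ABC.Theorems.ThetaPartII.ABC_of_cor312_of_hullRegime (fun P₀ hP l hl h5 hc h2 h5' h6 => ?_) hreg
  intro T
  letI := T.instFieldF; letI := T.instNumberFieldF; letI := T.instFieldK; letI := T.instNumberFieldK
  letI := T.instAlgebraK; letI := T.instFieldFbar; letI := T.instAlgebraFbar; letI := T.instAlgebraKFbar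
  letI := T.instIsElliptic
  obtain ⟨M, _, _, archPk, archSub, Ψ, act, Mmod, region, frobAdm, frobLogvol, frobΨ, frobMmod, unitImage, ballImage,
    thetaDiv, n, HT, LogLink, IsFull, lat, Frd, IsoF, Ob, realify, Strip, IsoS, Mv, _, sig, split, ObΔ, N, _, qData, tq, t, ρ, qK,
    htq0, htq1, htq, ht0, ht1, hplaces, hSH, hQPin, hΘ⟩ := HX P₀ hP l hl h5 hc h2 h5' h6 T
  -- the per-datum certificate BY NAME at `X := pilotDataOfF T.D`, its [READ] binder `hX` supplied by the PROVED
  -- `isPilotDataOf_pilotDataOfF T.D` (= abc-iut-C-cert-1's `cor312Of_of_SH_genuine_own`, p432254, unfolded one step)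
  exact cor312Of_of_SH_genuine T.D T.I (pilotDataOfF T.D) M archPk archSub Ψ act Mmod region frobAdm frobLogvol frobΨ frobMmod
    unitImage ballImage thetaDiv n lat sig split qData tq t ρ qK htq0 htq1 htq ht0 ht1 T.isVolumeInputOf
    (isPilotDataOf_pilotDataOfF T.D) hplaces hSH hQPin hΘ

end Summit.ABC.IUTFork.Conditional

end
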